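import Summits.QuantumFields.YangMills.Theorems.UnitScaleTiltProp7ChartSigmaT3GlevSU
import Summits.QuantumFields.YangMills.Theorems.UnitScaleTiltProp7Chart47T3Defs
import Summits.QuantumFields.YangMills.Theorems.UnitScaleTiltProp7SPrintIn19Dict
import Literature.MathematicalPhysics.QuantumFieldTheory.Balaban1983to89.B8Ineq1144TwistedAxial
import Literature.MathematicalPhysics.QuantumFieldTheory.Balaban1983to89.B8Eq155JBound
import HarnessLib

/-!
# `UnitScaleTiltProp7ChartSigmaT3OfRegPr` — ★w1's NAMED ROW `Prop7ChartT3.ChartSigmaT3 F n K e U₀` PROVED FOR EVERY (2)-REGULAR BACKGROUND AND SMALL `e`: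
# the (1.29)-restricted axial gauge fixing of a (19)-small perturbation `e^{iX}U₀` EXISTS at the T³ objects (route `UnitScaleTilt`, crux K1 «MinimiserStabilityRegPr»
# stmt-QuantumFields-19200, stub `stub_existenceMinimalOrbit`, route (α), (S3)(i); OWNER RULING g25-№3 §3(a) + 02:50:08Z (σ-5); def-free, count-neutral)

Cell `ym3-torus` (HUMAN RULING D-0037, YM ladder rung R3 — YM₃ on T³ is a rung, not d = 4, not a mass gap, not Clay).

WHAT.  `Prop7ChartT3.ChartSigmaT3 F n K e U₀` (★w1-19200 g2, `…Chart47T3Defs`: «every `X` bondwise Hermitian traceless with `nMax19 F n K U₀ X < e` has a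
(1.29)-restricted `u` with `(e^{iX}U₀)^u` in the axial gauge (1.19)», the displayed antecedent `hSig` of `Prop7Chart47T3.chart112_of_chart47_chartSigma_chart5`)
follows from `Prop7ChartSigmaT3GlevSU.exists_restrictedAxial_of_windows` once its windows are read from the route's letters: (1.139) for `U₀♯` from print's
regularity (2) `RegPr F n K ε₀ U₀` (`Prop7AxialReprPrint.inAk_pull_of_regPr`, `pdev_pull_lt`, `norm_plaqF_pull_sub_one_lt`); the size of `X` from (19)
(`Prop7TPrint.nMax19_lt_iff`: `‖X‖ < eη`, `‖∇¹_{U₀}X‖ < eη²`, with `Lᵏη = 1`, `Prop7SPrintIn19Dict.pow_mul_eta`); and (1.141) for `(e^{iX}U₀)♯` from [B8] (1.141)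
(`B8Ineq1144TwistedAxial.pdev_mulCfg_le`, through the pullback dictionary `Prop7SPrintIn19Dict.covGradT_pull` and `B8Eq155JBound.norm_expCfg_iEta_sub_one_le_of_141`).

WHAT IS PROVED (sorry-free, no definition): `iEta_pull_inv_eta` (`iη·(η⁻¹X♯) = iX♯`), `pdev_pull_emb15_le_of_regPr_of_nMax19` ((1.141) at the T³ objects:
`pdev ((e^{iX}U₀)♯) ≤ (2ε₀ + 3e)·L^{−2k}`), and ★★**`chartSigmaT3_of_regPr`**: for `0 < ε₀`, `0 < e` in the EXPLICIT windows below (functions of `d = 3` and `L` only;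
`α₀ = 2ε₀`, `α_P = 2ε₀ + 4e`, r05's `hsmall`∕`hc₃`∕`hsm` at `Lᵏb = e`), EVERY `U₀` with `RegPr F n K ε₀ U₀` satisfies `ChartSigmaT3 F n K e U₀`.
HONEST FRAMING.  Composition by name; the smallness windows are displayed as numeric hypotheses on `(ε₀, e)` (no attempt to optimise them); nothing of print asserted;
`--supports stmt-QuantumFields-19200 --as helper`.

References: T. Bałaban, CMP 102 (1985) 277–309 [Balaban1985Variational] ((2) p.278, (19)–(20) p.281, p.299); CMP 99 (1985) 75–102 [Balaban1985RegularSpaces]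
((1.139)–(1.144) p.100, (1.19) p.79, (1.29) p.81); CMP 98 (1985) 17–51 [Balaban1985Averaging] ((77)–(87) pp.30–31).
-/

set_option autoImplicit false

noncomputable section

namespace Summit.QuantumFields.YangMills.Theorems.Prop7ChartSigmaT3OfRegPr

open scoped Matrix.Norms.L2Operator
open NormedSpace
open Literature.MathematicalPhysics.QuantumFieldTheory.Balaban1983to89
open Literature.MathematicalPhysics.QuantumFieldTheory.Balaban1983to89.T3ContinuumYM3Torus
open Literature.MathematicalPhysics.QuantumFieldTheory.Balaban1983to89.T3PrintedRegularMinimiser (RegPr)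
open B7Prop1Explicit renaming Site → LSite
open B7Prop1Explicit (U1)
open B7Prop2Explicit (pdev C0 c2')
open B7Prop2SpecialUnitary (specialUnitaryUnits_le_U1)
open B7Prop3Flat (expCfg c3)
open B8Lemma1NonAbelian (mulCfg)
open B8Eq119TwistedAxial (mulCfg_eq_mul)
open B8Eq146AExpansion (iEta)
open B8Ineq132 (plaqF covDerivFwd)
open B8Ineq1144TwistedAxial (pdev_mulCfg_le)
open B8Eq155JBound (norm_expCfg_iEta_sub_one_le_of_141)
open B10Eq27TorusAxialLog (pull pull_apply transl unitsField toUField)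
open T3SectALandauChart (emb15 eta eta_pos bgUnits covGradT covGradT_eq_smul)
open Summit.QuantumFields.YangMills.Theorems.Prop7SPrint (basePt IsAxialPrint RestrictedPrint)
open Summit.QuantumFields.YangMills.Theorems.Prop7TPrint (nMax19 nMax19_lt_iff expHermField expHermField_apply coe_expHerm)
open Summit.QuantumFields.YangMills.Theorems.Prop7ChartT3 (ChartSigmaT3)
open Summit.QuantumFields.YangMills.Theorems.Prop7AxialReprPrint (pull_toUField_mem inAk_pull_of_regPr pdev_pull_lt norm_plaqF_pull_sub_one_lt)
open Summit.QuantumFields.YangMills.Theorems.Prop7SPrintIn19 (covGradT_pull covGradT_smul pow_mul_eta)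
open Summit.QuantumFields.YangMills.Theorems.Prop7ChartSigmaT3 (pull_emb15)
open Summit.QuantumFields.YangMills.Theorems.Prop7ChartSigmaT3GlevSU (pull_eq_expCfg_of_exp exists_restrictedAxial_of_windows)

variable (F : T3Family) {n K : ℕ}

/-- `iη·(η⁻¹X♯) = iX♯`: the `ℤᵈ` lane's exponent letter `iEta η A` at `A := η⁻¹X♯` is the pulled-back exponent `iX♯` (`η ≠ 0`). [cite: Balaban1985Variational, (19) p.281] -/
theorem iEta_pull_inv_eta (X : PBond (F.P K) 0 → Matrix (Fin 2) (Fin 2) ℂ) (x₀ : Site (F.P K) 0) :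
    iEta (eta F n K) (pull (fun b => (eta F n K)⁻¹ • X b) x₀) = fun z κ => Complex.I • X ⟨transl x₀ z, κ⟩ := by
  have hη : (eta F n K : ℂ) ≠ 0 := Complex.ofReal_ne_zero.2 (eta_pos F n K).ne'
  funext z κ
  simp only [iEta, pull_apply]
  rw [← Complex.coe_smul, smul_smul, Complex.ofReal_inv, mul_assoc, mul_inv_cancel₀ hη, mul_one]

/-- **(1.141) AT THE T³ OBJECTS**: for a (2)-regular `U₀` (`RegPr F n K ε₀ U₀`) and a bondwise Hermitian `X` of (19)-size `< e` relative to `U₀`, the based pullback of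
`e^{iX}U₀` has all plaquette variables within `(2ε₀ + 3e)·L^{−2k}` of `1` (`B8Ineq1144TwistedAxial.pdev_mulCfg_le` through the pullback dictionary; `2ε₀ ≤ ⅛`, `e ≤ 1∕20`).
[cite: Balaban1985RegularSpaces, (1.141) p.100; Balaban1985Variational, (2) p.278, (19) p.281] -/
theorem pdev_pull_emb15_le_of_regPr_of_nMax19 {ε₀ e : ℝ} (hε : 0 < ε₀) (he : 0 ≤ e) (hε8 : 2 * ε₀ ≤ 1 / 8) (he20 : e ≤ 1 / 20)
    (U₀ U₁ : GaugeField (F.P K) 0 (Matrix.specialUnitaryGroup (Fin 2) ℂ)) (hU : RegPr F n K ε₀ U₀) (X : PBond (F.P K) 0 → Matrix (Fin 2) (Fin 2) ℂ)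
    (hXh : ∀ b : PBond (F.P K) 0, (X b).IsHermitian)
    (hU₁ : ∀ b : PBond (F.P K) 0, ((U₁ b : Matrix.specialUnitaryGroup (Fin 2) ℂ) : Matrix (Fin 2) (Fin 2) ℂ) = exp (Complex.I • X b))
    (hX : nMax19 F n K U₀ X < e) :
    pdev (pull (unitsField (toUField (emb15 U₀ U₁))) (basePt F n K))
      ≤ (2 * ε₀ + 3 * e) * ((((F.P K).L : ℝ) ^ (K - n))⁻¹) ^ 2 := by
  letI : CStarAlgebra (Matrix (Fin 2) (Fin 2) ℂ) := B10Eq29TubeLine.cstarAlgebraMatrix 2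
  have hη : 0 < eta F n K := eta_pos F n K
  have hL1 : 1 ≤ (F.P K).L := (F.P K).hL.2.le
  have hLη : ((F.P K).L : ℝ) ^ (K - n) * eta F n K = 1 := pow_mul_eta F n K
  obtain ⟨h19a, h19b, -, -⟩ := (nMax19_lt_iff (F := F) (n := n) (K := K)).1 hX
  set x₀ := basePt F n K
  set A : LSite (F.P K).d → Fin (F.P K).d → Matrix (Fin 2) (Fin 2) ℂ := pull (fun b => (eta F n K)⁻¹ • X b) x₀ with hAdef
  have hexp : pull (unitsField (toUField U₁)) x₀ = expCfg (iEta (eta F n K) A) := by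
    rw [hAdef, iEta_pull_inv_eta]; exact pull_eq_expCfg_of_exp F U₁ X hU₁ x₀
  have hAk := inAk_pull_of_regPr F (n := n) (K := K) hε.le hU
  -- the hypotheses of (1.141)
  have h₀ : ∀ y κ, pull (unitsField (toUField U₀)) x₀ y κ ∈ U1 (Matrix (Fin 2) (Fin 2) ℂ) := fun y κ =>
    specialUnitaryUnits_le_U1 (pull_toUField_mem U₀ x₀ y κ)
  have h₁ : ∀ y κ, expCfg (iEta (eta F n K) A) y κ ∈ U1 (Matrix (Fin 2) (Fin 2) ℂ) := fun y κ => by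
    rw [← hexp]; exact specialUnitaryUnits_le_U1 (pull_toUField_mem U₁ x₀ y κ)
  have hAsa : ∀ y κ, IsSelfAdjoint (A y κ) := fun y κ => by
    show IsSelfAdjoint ((eta F n K)⁻¹ • X ⟨transl x₀ y, κ⟩)
    rw [IsSelfAdjoint, star_smul, star_trivial, Matrix.star_eq_conjTranspose, (hXh _).eq]
  have hAb : ∀ y κ, ‖A y κ‖ ≤ e * (((F.P K).L : ℝ) ^ (K - n) * eta F n K)⁻¹ := fun y κ => by
    rw [hLη, inv_one, mul_one]
    show ‖(eta F n K)⁻¹ • X ⟨transl x₀ y, κ⟩‖ ≤ e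
    rw [norm_smul, norm_inv, Real.norm_of_nonneg hη.le]
    have := h19a ⟨transl x₀ y, κ⟩
    rw [inv_mul_le_iff₀ hη]; linarith
  have hu := norm_expCfg_iEta_sub_one_le_of_141 hη.le hAsa hAb
  have hG : ∀ (y : LSite (F.P K).d) (κ τ : Fin (F.P K).d),
      ‖covDerivFwd (eta F n K) (pull (unitsField (toUField U₀)) x₀) κ (fun z => A z τ) y‖ ≤ e * ((((F.P K).L : ℝ) ^ (K - n) * eta F n K)⁻¹) ^ 2 := by
    intro y κ τ
    rw [hLη, inv_one, one_pow, mul_one]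
    have hd : covDerivFwd (eta F n K) (pull (unitsField (toUField U₀)) x₀) κ (fun z => A z τ) y
        = covGradT (eta F n K) (bgUnits F K U₀) (fun b => (eta F n K)⁻¹ • X b) κ τ (transl x₀ y) :=
      covGradT_pull (eta F n K) (bgUnits F K U₀) (fun b => (eta F n K)⁻¹ • X b) x₀ κ τ y
    rw [hd, covGradT_smul, covGradT_eq_smul, norm_smul, norm_smul, norm_inv, Real.norm_of_nonneg hη.le]
    have h2 := h19b κ τ (transl x₀ y)
    have hη2 : 0 < eta F n K ^ 2 := pow_pos hη 2
    calc (eta F n K)⁻¹ * ((eta F n K)⁻¹ * ‖covGradT 1 (bgUnits F K U₀) X κ τ (transl x₀ y)‖)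
        = (eta F n K ^ 2)⁻¹ * ‖covGradT 1 (bgUnits F K U₀) X κ τ (transl x₀ y)‖ := by ring
      _ ≤ (eta F n K ^ 2)⁻¹ * (e * eta F n K ^ 2) := mul_le_mul_of_nonneg_left h2.le (inv_nonneg.2 hη2.le)
      _ = e := by field_simp
  have h7 : ∀ (y : LSite (F.P K).d) (κ ν : Fin (F.P K).d), κ ≠ ν →
      ‖plaqF (pull (unitsField (toUField U₀)) x₀) κ ν y - 1‖ < 2 * ε₀ * ((((F.P K).L : ℝ) ^ (K - n))⁻¹) ^ 2 := by
    intro y κ ν hne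
    have h1 := norm_plaqF_pull_sub_one_lt hAk x₀ y hne
    have hpos : 0 < ε₀ * ((((F.P K).L : ℝ) ^ (K - n))⁻¹) ^ 2 := by
      have : 0 < (((F.P K).L : ℝ) ^ (K - n))⁻¹ := inv_pos.2 (pow_pos (by exact_mod_cast (F.P K).L_pos) _)
      positivity
    linarith
  -- the `ℤᵈ` lane's two `expCfg` letters (`B7Prop3Flat`, `B8Eq146AExpansion`) agree definitionally
  have h₁' : ∀ y κ, B8Eq146AExpansion.expCfg (iEta (eta F n K) A) y κ ∈ U1 (Matrix (Fin 2) (Fin 2) ℂ) := h₁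
  have hmain := pdev_mulCfg_le hη h₀ h₁' hL1 (by positivity : (0 : ℝ) ≤ 2 * ε₀) hε8 he he20 hu hAb hG h7
  have hcfg : mulCfg (B8Eq146AExpansion.expCfg (iEta (eta F n K) A)) (pull (unitsField (toUField U₀)) x₀)
      = pull (unitsField (toUField (emb15 U₀ U₁))) x₀ := by
    rw [pull_emb15, hexp]; rfl
  rw [hcfg] at hmain
  exact hmain

/-- **`ChartSigmaT3` FOR EVERY (2)-REGULAR BACKGROUND** ([B11] p.299; [6] p.81): in the explicit windows on `(ε₀, e)` below (functions of `d = 3` and `L` only; `α₀ = 2ε₀`,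
`α_P = 2ε₀ + 4e`, r05's Prop-7 windows at `Lᵏb = e`), every `U₀` with `RegPr F n K ε₀ U₀` satisfies ★w1-19200's named row `Prop7ChartT3.ChartSigmaT3 F n K e U₀`: for every
bondwise Hermitian traceless `X` with `nMax19 F n K U₀ X < e` there is a (1.29)-restricted torus gauge transformation `u` with `(e^{iX}U₀)^u` in the axial gauge (1.19)
(`Prop7ChartSigmaT3GlevSU.exists_restrictedAxial_of_windows` with its windows discharged by §1 and `Prop7AxialReprPrint.pdev_pull_lt`).
[cite: Balaban1985Variational, (2) p.278, (19)–(20) p.281, p.299; Balaban1985RegularSpaces, Prop. 7 p.100, (1.19) p.79, (1.29) p.81; Balaban1985Averaging, (77)–(87) pp.30–31] -/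
theorem chartSigmaT3_of_regPr {ε₀ e : ℝ} (hε : 0 < ε₀) (he : 0 < e)
    (hα3 : C0 (F.P K).d * (2 * ε₀) ≤ 1 / 3) (hα4 : 4 * (2 * ε₀) ≤ c2' (F.P K).d (F.P K).L) (hε8 : 2 * ε₀ ≤ 1 / 8) (he20 : e ≤ 1 / 20)
    (hsmall : Real.exp (4 * (800 * (((F.P K).d : ℝ) + 1) ^ 2 * (((F.P K).d : ℝ) + 4)) * (2 * ε₀))
      * (1 + 8 * (131072 * (((F.P K).d : ℝ) + 1) ^ 2) * e) ≤ 2)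
    (hc₃ : 2 * e ≤ c3 (F.P K).d (F.P K).L) (hsm : 2048 * ((F.P K).d : ℝ) * e ≤ 1)
    (hαP3 : C0 (F.P K).d * (2 * ε₀ + 4 * e) ≤ 1 / 3) (hαP2 : 2 * (2 * ε₀ + 4 * e) ≤ c2' (F.P K).d (F.P K).L)
    (U₀ : GaugeField (F.P K) 0 (Matrix.specialUnitaryGroup (Fin 2) ℂ)) (hU : RegPr F n K ε₀ U₀) :
    ChartSigmaT3 F n K e U₀ := by
  intro X hXh hX
  have hη : 0 < eta F n K := eta_pos F n K
  have hLη : ((F.P K).L : ℝ) ^ (K - n) * eta F n K = 1 := pow_mul_eta F n K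
  have hLb : ((F.P K).L : ℝ) ^ (K - n) * (e * eta F n K) = e := by
    rw [mul_left_comm, hLη, mul_one]
  have hU₁ : ∀ b : PBond (F.P K) 0,
      ((expHermField (F := F) (K := K) X b : Matrix.specialUnitaryGroup (Fin 2) ℂ) : Matrix (Fin 2) (Fin 2) ℂ) = exp (Complex.I • X b) := fun b => by
    rw [expHermField_apply, coe_expHerm (hXh b)]
  obtain ⟨h19a, -, -, -⟩ := (nMax19_lt_iff (F := F) (n := n) (K := K)).1 hX
  have h52 := pdev_pull_lt (P := F.P K) hε (inAk_pull_of_regPr F (n := n) (K := K) hε.le hU) (basePt F n K)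
  have hLpos : 0 < ((((F.P K).L : ℝ) ^ (K - n))⁻¹) ^ 2 := by
    have : 0 < (((F.P K).L : ℝ) ^ (K - n))⁻¹ := inv_pos.2 (pow_pos (by exact_mod_cast (F.P K).L_pos) _)
    positivity
  have hP : pdev (pull (unitsField (toUField (emb15 U₀ (expHermField (F := F) (K := K) X)))) (basePt F n K))
      < (2 * ε₀ + 4 * e) * ((((F.P K).L : ℝ) ^ (K - n))⁻¹) ^ 2 := by
    have h := pdev_pull_emb15_le_of_regPr_of_nMax19 F hε he.le hε8 he20 U₀ (expHermField (F := F) (K := K) X) hU X (fun b => (hXh b).1) hU₁ hX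
    have : (2 * ε₀ + 3 * e) * ((((F.P K).L : ℝ) ^ (K - n))⁻¹) ^ 2 < (2 * ε₀ + 4 * e) * ((((F.P K).L : ℝ) ^ (K - n))⁻¹) ^ 2 :=
      mul_lt_mul_of_pos_right (by linarith) hLpos
    exact h.trans_lt this
  exact exists_restrictedAxial_of_windows F U₀ (expHermField (F := F) (K := K) X) X hU₁ (by positivity) hα3 hα4 h52 (by positivity)
    (fun bd => (h19a bd).le) (by rw [hLb]; exact hsmall) (by rw [hLb]; exact hc₃) (by rw [hLb]; exact hsm) (by positivity) hαP3 hαP2 hP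

end Summit.QuantumFields.YangMills.Theorems.Prop7ChartSigmaT3OfRegPr

end
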